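import Summits.BirchSwinnertonDyer.Rank1Residual.X2.IsogenyLineType
import Summits.BirchSwinnertonDyer.Rank1Residual.X2.IsogenyQuotientLine
import Summits.BirchSwinnertonDyer.Rank1Residual.X2.Cells
import Literature.NumberTheory.EllipticCurves.Rank1Residual.GVParityIsogenyClassProofs
import Literature.NumberTheory.EllipticCurves.ComplexMultiplicationLFunctionIsogenyHoldsProofs
import HarnessLib

/-!
# The Eisenstein classes X2 / X3 and the sub-partition X2a / X2b / X2c are constant on
# `ℚ`-isogeny classes (cell `b2b-bsdres`; off-peak typer `lit-cgls`, session 8 — an elementary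
# reduction for CLASS-CLOSURE-PLAN §3.7 O9 / §3.15 N9, experiment type E3 "isogeny transport")

HONEST FRAMING (run/shared/lean/b2b/bsd-rank1-residual/, verbatim in every file): the goal of the
cell is to DELETE the COMBINATION-SHAPED residual classes of the Birch–Swinnerton-Dyer formula for
ALL analytic-rank `≤ 1` elliptic curves over `ℚ` — "full BSD formula for every rank `≤ 1` curve in
class `C`" assembled STRICTLY from published theorems — so that the rank-`≤ 1` remainder becomes
exactly the CONSTRUCTION-SHAPED classes, which are TYPED (missing-input `Prop`s), NOT attempted.
This is not "finishing BSD". Research route; NO CLAIM BEYOND STATED CLASSES; nothing here changes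
a label; nothing is booked. THEOREMS ONLY (no definition, no named fact, no `sorry`).

## Why (CLASS-CLOSURE-PLAN §3.7 O9 and §3.15 N9, experiment E3)

For the multiplicative Eisenstein class X2 (`p` odd, `E[p]` reducible, `p ‖ N`; sub-cells
X2a = `r = 0 ∧ gvpar`, X2b = `r = 0 ∧ ¬gvpar`, X2c = `r = 1`, file `X2/Cells.lean`) the plan lists
as a CENSUS the question "does a `ℚ`-isogenous curve of an X2 pair land in a CLOSED cell?"
(§3.7: "3-isogeny to X1a/X2-type pairs (Cassels in kernel — check whether the isogenous curve lands
in a CLOSED cell: pure census, zero theory)"; §3.15 X2a/X2b). This file answers it in the kernel,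
with no census: **every clause of `ClassX2`, of `ClassX3`, and of the three sub-cells of X2 is a
`ℚ`-isogeny invariant**, so an isogenous curve of an X2a / X2b / X2c / X3 pair lies in the SAME
(sub-)cell at `p` — the E3 isogeny transport is the identity on these cells (only per-pair data
that are NOT isogeny-invariant, e.g. `#Ш_an` in Wuthrich's Prop. 21 lever, can differ inside an
isogeny class; `BSD(E,p)` itself is isogeny-invariant by Cassels, tree `bsdp_iff_of_isIsogenous`).

The one non-formal input is the Greenberg–Vatsal parity type at a MULTIPLICATIVE prime. At a good
ordinary prime its isogeny invariance is x1a's `gvPar_iff_of_isIsogenous_of_not_dvd_frobeniusTrace`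
(`GVParityIsogenyClassProofs.lean`: Serre's ordinary line (hL) + the Weil-pairing signs (hc) fed to
`gvPar_iff_of_isogeny`). At an odd `p ‖ N` the local input (hL) is the TATE LINE `C[p] ≅ μ_p`
(inertia acts on `E[p]` through `(ω *; 0 1)`), which eisenstein-p2 gen 18 produced at ONE prime of
`\bar ℤ` above `p` (`X2.IsogenyLineType.exists_tateLine_adicCompletionPrime`, from the Tate
uniformisation named facts `hT`, `hT'` = Silverman *ATAEC* V.5.3 / Cor. V.5.4, as everywhere in the
X2 kernel). Here:

* §1 `forall_primesAbove_of_line` — pure Galois modules: a line `L₀ ≤ E[p]` with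
  `(σ - 1)E[p] ⊆ L₀` for `σ ∈ I_{𝔓₀}` and moved by `I_{𝔓₀}` at ONE prime `𝔓₀ ∣ p` of `\bar ℤ` gives
  such a line (`g • L₀`) at EVERY prime `𝔓 = g • 𝔓₀` above `p` (`I_{g𝔓₀} = g I_{𝔓₀} g⁻¹`,
  Neukirch I (9.4): tree `Ideal.conj_mem_inertia_smul_iff`; transitivity on the primes above `p`:
  `HeightOneSpectrum.exists_smul_eq_of_mem_primesAbove_holds`);
* §2 `exists_tateLine` — (hL) at EVERY prime above an odd multiplicative `p` (from §1 and
  `exists_tateLine_adicCompletionPrime`);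
* §3 `gvPar_iff_of_isIsogenous_of_mult` — **`GVPar W p ↔ GVPar W' p` for `ℚ`-isogenous globally
  minimal `W, W'` at an odd prime of multiplicative reduction** (granted `hT`, `hT'`), the
  multiplicative twin of `gvPar_iff_of_isIsogenous_of_not_dvd_frobeniusTrace`;
* §4 `addv_iff_of_isIsogenous`, `classX2_iff_of_isIsogenous`, `classX3_iff_of_isIsogenous`,
  `classX4_iff_of_isIsogenous` (unconditional), `cellC_iff_of_isIsogenous` (unconditional),
  `cellA_iff_of_isIsogenous`, `cellB_iff_of_isIsogenous` (granted `hT`, `hT'`), and the E3 reading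
  `not_cellA_of_cellB_of_isIsogenous`: **no X2b pair has an X2a (CLOSED, `X2/RankZero.lean`) curve
  in its `ℚ`-isogeny class.**

Inputs, all theorems of the tree: reducibility of `E[p]` along an isogeny
(`not_hasIrreducibleModPGaloisRep_of_isIsogenous`, x1a), good / multiplicative reduction at `p`
(`IsIsogenous.hasGoodReductionAtPrime_iff`, Serre–Tate *AEC* VII.7.2;
`X2.IsogenyQuotientLine.hasMultiplicativeReductionAtPrime_of_isIsogenous`, eisenstein-p2), the
analytic rank (`analyticRank_eq_of_isIsogenous'`, Knapp 11.67), an isogeny not killing `E[p]` in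
each direction (`exists_isogeny_apply_ne_zero`, *AEC* III.4.11), and the parity transfer
`gvPar_iff_of_isogeny_of_ordinaryLine` (x1a). Nothing about any particular curve is asserted.

References: [GreenbergVatsal2000] Thm. (1.3) (the parity condition), §2 p. 28, pp. 14–15;
[SilvermanATAEC1994] Thm. V.5.3, Cor. V.5.4; [SilvermanAEC2009] III.4.11, VII.7.2;
[NeukirchANT1999] I §9 (9.1), (9.4); HOME/CLASS-CLOSURE-PLAN.md §3.7, §3.15;
HOME/b2b-bsdres-lit-cgls/CGLS-GV-TYPING.md §15.
-/

set_option autoImplicit false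

noncomputable section

open scoped Classical

open WeierstrassCurve Literature.NumberTheory.EllipticCurves Literature.NumberTheory.GaloisRepresentations
  Field IsDedekindDomain NumberField
  Literature.NumberTheory.EllipticCurves.Rank1Residual

namespace Summit.BirchSwinnertonDyer.Rank1Residual.X2

variable {W W' : WeierstrassCurve ℚ} {p : ℕ} [hp : Fact p.Prime]

/-! ## §1. Galois modules: a local line at one prime above `p` gives one at every prime above `p` -/

omit hp in
/-- **Spreading the local line by conjugation.** Let `𝔓₀` be a prime of `\bar ℤ` above the place
`v` of `ℚ`, and `L₀ ≤ E[p]` a subgroup of order `p` with `σ • P - P ∈ L₀` for all `σ ∈ I_{𝔓₀}`,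
`P ∈ E[p]`, and some `σ ∈ I_{𝔓₀}` moving a point of `L₀`. Then at EVERY prime `𝔓` above `v` there
is such a subgroup: `𝔓 = g • 𝔓₀` for some `g ∈ Γ_ℚ` (the primes above `v` are conjugate), and
`L = g • L₀` works because `I_{g𝔓₀} = g I_{𝔓₀} g⁻¹`. [cite: NeukirchANT1999, Ch. I §9 (9.1), (9.4)] -/
theorem forall_primesAbove_of_line {v : HeightOneSpectrum (𝓞 ℚ)}
    {𝔓₀ : Ideal (absIntegers (𝓞 ℚ) ℚ)} (h𝔓₀ : 𝔓₀ ∈ v.primesAbove)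
    {L₀ : AddSubgroup (geomTorsion W (p : ℤ))} (hcard : Nat.card L₀ = p)
    (htriv : ∀ σ ∈ 𝔓₀.inertia (absoluteGaloisGroup ℚ), ∀ P : geomTorsion W (p : ℤ), σ • P - P ∈ L₀)
    (hmov : ∃ σ ∈ 𝔓₀.inertia (absoluteGaloisGroup ℚ), ∃ P ∈ L₀, σ • P ≠ P) :
    ∀ 𝔓 ∈ v.primesAbove, ∃ L : AddSubgroup (geomTorsion W (p : ℤ)), Nat.card L = p ∧
      (∀ σ ∈ 𝔓.inertia (absoluteGaloisGroup ℚ), ∀ P : geomTorsion W (p : ℤ), σ • P - P ∈ L) ∧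
      (∃ σ ∈ 𝔓.inertia (absoluteGaloisGroup ℚ), ∃ P ∈ L, σ • P ≠ P) := by
  intro 𝔓 h𝔓
  obtain ⟨g, hg⟩ := HeightOneSpectrum.exists_smul_eq_of_mem_primesAbove_holds h𝔓₀ h𝔓
  rw [← hg]
  -- the translate `g • L₀`, as the image of `L₀` under the additive automorphism `P ↦ g • P`
  let φ : geomTorsion W (p : ℤ) →+ geomTorsion W (p : ℤ) :=
    DistribSMul.toAddMonoidHom (geomTorsion W (p : ℤ)) g
  have hφ : ∀ P : geomTorsion W (p : ℤ), φ P = g • P := fun P ↦ rfl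
  have hφinj : Function.Injective φ := fun P Q hPQ ↦ MulAction.injective g (by simpa [hφ] using hPQ)
  refine ⟨L₀.map φ, ?_, ?_, ?_⟩
  · -- `#(g • L₀) = #L₀ = p`
    exact (Nat.card_congr (L₀.equivMapOfInjective φ hφinj).toEquiv).symm.trans hcard
  · -- `σ ∈ I_{g𝔓₀}` is `g τ g⁻¹` with `τ ∈ I_{𝔓₀}`, and `σ • P - P = g • (τ • g⁻¹P - g⁻¹P)`
    intro σ hσ P
    set τ : absoluteGaloisGroup ℚ := g⁻¹ * σ * g with hτdef
    have hστ : g * τ * g⁻¹ = σ := by rw [hτdef]; group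
    have hτ : τ ∈ 𝔓₀.inertia (absoluteGaloisGroup ℚ) :=
      (Ideal.conj_mem_inertia_smul_iff 𝔓₀ g τ).mp (hστ ▸ hσ)
    have hmem : τ • (g⁻¹ • P) - g⁻¹ • P ∈ L₀ := htriv τ hτ (g⁻¹ • P)
    refine AddSubgroup.mem_map.mpr ⟨τ • (g⁻¹ • P) - g⁻¹ • P, hmem, ?_⟩
    rw [map_sub, hφ, hφ, smul_inv_smul, ← mul_smul, ← mul_smul, ← hστ]
  · -- a point of `L₀` moved by `σ₀ ∈ I_{𝔓₀}` gives a point of `g • L₀` moved by `g σ₀ g⁻¹`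
    obtain ⟨σ₀, hσ₀, P₀, hP₀, hne⟩ := hmov
    refine ⟨g * σ₀ * g⁻¹, (Ideal.conj_mem_inertia_smul_iff 𝔓₀ g σ₀).mpr hσ₀, g • P₀,
      AddSubgroup.mem_map.mpr ⟨P₀, hP₀, rfl⟩, ?_⟩
    intro heq
    apply hne
    rw [mul_smul, mul_smul, inv_smul_smul] at heq
    exact MulAction.injective g heq

/-! ## §2. The Tate line at EVERY prime above an odd multiplicative `p` -/

section TateLine

variable (W p) [W.IsElliptic] [W.IsGloballyMinimal]

/-- **(hL) at an odd multiplicative prime, at every prime of `\bar ℤ` above `p`.** For `E/ℚ`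
globally minimal with multiplicative reduction at the odd prime `p`: at every prime `𝔓` above
`p` there is a line `L ≤ E[p]` of order `p` with `(σ - 1)E[p] ⊆ L` for all `σ ∈ I_𝔓` and some
`σ ∈ I_𝔓` moving a point of `L` (the Tate line `C[p] ≅ μ_p`: inertia acts on `E[p]` through
`(ω *; 0 1)`). From `exists_tateLine_adicCompletionPrime` (one prime, Tate uniformisation facts
`hT`, `hT'`) and §1. [cite: SilvermanATAEC1994, Thm. V.5.3 and Cor. V.5.4]
[cite: GreenbergVatsal2000, §2 pp. 14–15] -/
theorem exists_tateLine
    (hT : Silverman1994_thmV53_tateUniformisation.{0})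
    (hT' : Silverman1994_thmV53_corV54_tateUniformisation.{0})
    (hp2 : p ≠ 2) (hmult : W.HasMultiplicativeReductionAtPrime p) :
    ∀ (v : HeightOneSpectrum (𝓞 ℚ)), (p : 𝓞 ℚ) ∈ v.asIdeal → ∀ 𝔓 ∈ v.primesAbove,
      ∃ L : AddSubgroup (geomTorsion W (p : ℤ)), Nat.card L = p ∧
        (∀ σ ∈ 𝔓.inertia (absoluteGaloisGroup ℚ), ∀ P : geomTorsion W (p : ℤ), σ • P - P ∈ L) ∧
        (∃ σ ∈ 𝔓.inertia (absoluteGaloisGroup ℚ), ∃ P ∈ L, σ • P ≠ P) := by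
  intro v hv 𝔓 h𝔓
  obtain ⟨v₀, hv₀, 𝔓₀, h𝔓₀, L₀, hcard, htriv, hmov⟩ :=
    IsogenyLineType.exists_tateLine_adicCompletionPrime W p hT hT' hp2 hmult
  have hvv : v₀ = v := heightOneSpectrum_eq_of_natCast_mem hp.out hv₀ hv
  subst hvv
  exact forall_primesAbove_of_line h𝔓₀ hcard htriv hmov 𝔓 h𝔓

end TateLine

/-! ## §3. The Greenberg–Vatsal parity type at a multiplicative prime is an isogeny-class invariant -/

section Parity

variable [W.IsElliptic] [W'.IsElliptic] [W.IsGloballyMinimal] [W'.IsGloballyMinimal]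

/-- **`GVPar` is a function of the `ℚ`-isogeny class at an odd multiplicative prime.** For
globally minimal `W, W'` over `ℚ`, `p ≠ 2` a prime of multiplicative reduction of `W`, and
`IsIsogenous W W'`: `GVPar W p ↔ GVPar W' p` — granted the Tate uniformisation facts `hT`, `hT'`
(for the Tate line (hL) of both curves; `W'` is multiplicative at `p` too,
`hasMultiplicativeReductionAtPrime_of_isIsogenous`). Proof: isogenies not killing `E[p]` in both
directions (`exists_isogeny_apply_ne_zero`) and x1a's `gvPar_iff_of_isogeny_of_ordinaryLine`, whose
(hL) is any local line with `(σ - 1)E[p] ⊆ L`, `I_𝔓 ↠` non-trivial on `L` — here the Tate line.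
The multiplicative twin of `gvPar_iff_of_isIsogenous_of_not_dvd_frobeniusTrace`; it is the
isogeny-class form of Greenberg–Vatsal's remark that their parity hypothesis passes to `E/Φ`
(§2 p. 28). [cite: GreenbergVatsal2000, Thm. (1.3) and §2 p. 28] -/
theorem gvPar_iff_of_isIsogenous_of_mult
    (hT : Silverman1994_thmV53_tateUniformisation.{0})
    (hT' : Silverman1994_thmV53_corV54_tateUniformisation.{0})
    (hp2 : p ≠ 2) (hmult : W.HasMultiplicativeReductionAtPrime p) (h : IsIsogenous W W') :
    GVPar W p ↔ GVPar W' p := by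
  have hmult' : W'.HasMultiplicativeReductionAtPrime p :=
    IsogenyQuotientLine.hasMultiplicativeReductionAtPrime_of_isIsogenous h hmult
  obtain ⟨f, P, hP, hf⟩ := exists_isogeny_apply_ne_zero (p := p) h
  obtain ⟨f', P', hP', hf'⟩ := exists_isogeny_apply_ne_zero (p := p) h.symm_of_charZero
  exact gvPar_iff_of_isogeny_of_ordinaryLine hp2 (exists_tateLine W p hT hT' hp2 hmult)
    (exists_tateLine W' p hT hT' hp2 hmult') f ⟨P, hP, hf⟩ f' ⟨P', hP', hf'⟩

end Parity

/-! ## §4. The classes X2, X3, X4 and the sub-cells of X2 along a `ℚ`-isogeny -/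

section Classes

variable [W.IsElliptic] [W'.IsElliptic]

/-- **Multiplicative reduction at `p` is a `ℚ`-isogeny invariant** (iff form of eisenstein-p2's
`hasMultiplicativeReductionAtPrime_of_isIsogenous`, *AEC* VII.7.2 / §C.16).
[cite: SilvermanAEC2009, Cor. VII.7.2 and §C.16] -/
theorem mult_iff_of_isIsogenous (h : IsIsogenous W W') : Mult W p ↔ Mult W' p :=
  ⟨IsogenyQuotientLine.hasMultiplicativeReductionAtPrime_of_isIsogenous h,
    IsogenyQuotientLine.hasMultiplicativeReductionAtPrime_of_isIsogenous h.symm_of_charZero⟩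

/-- **Reducibility of `E[p]` is a `ℚ`-isogeny invariant** (iff form of x1a's
`not_hasIrreducibleModPGaloisRep_of_isIsogenous`: a rational line is transported along an isogeny
not killing `E[p]`). [folklore] -/
theorem red_iff_of_isIsogenous (h : IsIsogenous W W') : Red W p ↔ Red W' p :=
  ⟨not_hasIrreducibleModPGaloisRep_of_isIsogenous (p := p) h,
    not_hasIrreducibleModPGaloisRep_of_isIsogenous (p := p) h.symm_of_charZero⟩

/-- **Additive reduction at `p` is a `ℚ`-isogeny invariant**, unconditionally: `Addv` is "neither
good nor multiplicative", and both are invariant (Serre–Tate, `IsIsogenous.hasGoodReductionAtPrime_iff`;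
`mult_iff_of_isIsogenous`). (The additive files' `Addv.of_isIsogenous_of_typeG` carries a (G)
hypothesis only because it predates the multiplicative transport.) [cite: SilvermanAEC2009, Cor. VII.7.2] -/
theorem addv_iff_of_isIsogenous (h : IsIsogenous W W') : Addv W p ↔ Addv W' p := by
  unfold Addv
  exact and_congr (not_congr (h.hasGoodReductionAtPrime_iff p))
    (not_congr (mult_iff_of_isIsogenous (p := p) h))

/-- **Class X2 (`p` odd, `E[p]` reducible, `p ‖ N`) is a property of the `ℚ`-isogeny class.**
[folklore] -/
theorem classX2_iff_of_isIsogenous (h : IsIsogenous W W') : ClassX2 W p ↔ ClassX2 W' p := by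
  unfold ClassX2
  rw [red_iff_of_isIsogenous h, mult_iff_of_isIsogenous h]

/-- **Class X3 (`E[p]` reducible, additive at `p`) is a property of the `ℚ`-isogeny class.**
[folklore] -/
theorem classX3_iff_of_isIsogenous (h : IsIsogenous W W') : ClassX3 W p ↔ ClassX3 W' p := by
  unfold ClassX3
  rw [red_iff_of_isIsogenous h, addv_iff_of_isIsogenous h]

/-- **Class X4 (`p` odd, additive at `p`, `E[p]` irreducible) is a property of the `ℚ`-isogeny
class** (free from the two previous invariances; recorded for the additive seats). [folklore] -/
theorem classX4_iff_of_isIsogenous (h : IsIsogenous W W') : ClassX4 W p ↔ ClassX4 W' p := by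
  have hred : ¬ W.HasIrreducibleModPGaloisRep p ↔ ¬ W'.HasIrreducibleModPGaloisRep p :=
    red_iff_of_isIsogenous (p := p) h
  unfold ClassX4
  exact and_congr Iff.rfl (and_congr (addv_iff_of_isIsogenous h) (not_iff_not.mp hred))

/-- **Sub-cell X2c (`r = 1`) is a property of the `ℚ`-isogeny class**, unconditionally (equal
`L`-functions, Knapp 11.67: `analyticRank_eq_of_isIsogenous'`). [folklore] -/
theorem cellC_iff_of_isIsogenous (h : IsIsogenous W W') : CellC W p ↔ CellC W' p := by
  unfold CellC
  rw [analyticRank_eq_of_isIsogenous' h, classX2_iff_of_isIsogenous h]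

variable [W.IsGloballyMinimal] [W'.IsGloballyMinimal]

/-- **Sub-cell X2a (`r = 0 ∧ gvpar`, the Greenberg–Vatsal cell, CLOSED in `X2/RankZero.lean`) is a
property of the `ℚ`-isogeny class** (granted the Tate uniformisation facts `hT`, `hT'` for the
parity clause, §3). [cite: GreenbergVatsal2000, Thm. (1.3) and §2 p. 28] -/
theorem cellA_iff_of_isIsogenous
    (hT : Silverman1994_thmV53_tateUniformisation.{0})
    (hT' : Silverman1994_thmV53_corV54_tateUniformisation.{0})
    (h : IsIsogenous W W') : CellA W p ↔ CellA W' p := by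
  constructor
  · rintro ⟨hr, hX, hpar⟩
    exact ⟨(analyticRank_eq_of_isIsogenous' h) ▸ hr, (classX2_iff_of_isIsogenous h).mp hX,
      (gvPar_iff_of_isIsogenous_of_mult hT hT' hX.1 hX.2.2 h).mp hpar⟩
  · rintro ⟨hr, hX', hpar⟩
    have hX : ClassX2 W p := (classX2_iff_of_isIsogenous h).mpr hX'
    exact ⟨(analyticRank_eq_of_isIsogenous' h).symm ▸ hr, hX,
      (gvPar_iff_of_isIsogenous_of_mult hT hT' hX.1 hX.2.2 h).mpr hpar⟩

/-- **Sub-cell X2b (`r = 0 ∧ ¬gvpar`) is a property of the `ℚ`-isogeny class** (granted `hT`,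
`hT'`). [cite: GreenbergVatsal2000, Thm. (1.3) and §2 p. 28] -/
theorem cellB_iff_of_isIsogenous
    (hT : Silverman1994_thmV53_tateUniformisation.{0})
    (hT' : Silverman1994_thmV53_corV54_tateUniformisation.{0})
    (h : IsIsogenous W W') : CellB W p ↔ CellB W' p := by
  constructor
  · rintro ⟨hr, hX, hpar⟩
    exact ⟨(analyticRank_eq_of_isIsogenous' h) ▸ hr, (classX2_iff_of_isIsogenous h).mp hX,
      fun h' ↦ hpar ((gvPar_iff_of_isIsogenous_of_mult hT hT' hX.1 hX.2.2 h).mpr h')⟩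
  · rintro ⟨hr, hX', hpar⟩
    have hX : ClassX2 W p := (classX2_iff_of_isIsogenous h).mpr hX'
    exact ⟨(analyticRank_eq_of_isIsogenous' h).symm ▸ hr, hX,
      fun h' ↦ hpar ((gvPar_iff_of_isIsogenous_of_mult hT hT' hX.1 hX.2.2 h).mp h')⟩

/-- **E3 for N9 / O9 is empty: no X2b pair has an X2a curve in its `ℚ`-isogeny class** (and no X2c
pair has a rank-zero one, `cellC_iff_of_isIsogenous`): the isogeny transport of CLASS-CLOSURE-PLAN
§3.7 / §3.15 never moves an X2 pair into the closed Greenberg–Vatsal cell. Granted `hT`, `hT'`.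
[cite: GreenbergVatsal2000, Thm. (1.3) and §2 p. 28] -/
theorem not_cellA_of_cellB_of_isIsogenous
    (hT : Silverman1994_thmV53_tateUniformisation.{0})
    (hT' : Silverman1994_thmV53_corV54_tateUniformisation.{0})
    (hB : CellB W p) (h : IsIsogenous W W') : ¬ CellA W' p := fun hA ↦
  ((cellB_iff_of_isIsogenous hT hT' h).mp hB).2.2 hA.2.2

/-- The three-way reading for the census: along a `ℚ`-isogeny an X2 pair of analytic rank `≤ 1`
keeps its sub-cell — X2a ↦ X2a, X2b ↦ X2b, X2c ↦ X2c (granted `hT`, `hT'`). [folklore] -/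
theorem subcell_transport_of_isIsogenous
    (hT : Silverman1994_thmV53_tateUniformisation.{0})
    (hT' : Silverman1994_thmV53_corV54_tateUniformisation.{0})
    (h : IsIsogenous W W') :
    (CellA W p → CellA W' p) ∧ (CellB W p → CellB W' p) ∧ (CellC W p → CellC W' p) :=
  ⟨(cellA_iff_of_isIsogenous hT hT' h).mp, (cellB_iff_of_isIsogenous hT hT' h).mp,
    (cellC_iff_of_isIsogenous h).mp⟩

end Classes

end Summit.BirchSwinnertonDyer.Rank1Residual.X2

end
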